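import Literature.MathematicalPhysics.QuantumFieldTheory.Balaban1983to89.Node00.N01Dossier
import Literature.MathematicalPhysics.QuantumFieldTheory.Balaban1983to89.Node00.Carriers3
import Literature.MathematicalPhysics.QuantumFieldTheory.Balaban1983to89.B10Eq29TubeLine

/-!
# NODE N02 · [Balaban1984PropagatorsI] — DISCHARGE DOSSIER at the NODE 00 worlds of record (Stage 1, carried to Stages 2–3):
# the node BY NAME, its one in-edge CONSUMED (not refuted), its three printed legs IN KERNEL FORM at the objects of record,
# the re-indexing dictionary, non-vacuity, and «what this is not»

TRACK A (YM-PLAN §2, node N02 of 28; HUMAN RULING D-0062 «Track A at full width»), seat `pub-ymgap-dag-n02-a` (prover, -a KNIT-BY-NAME;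
chair R429 «START HERE», dag-lead NODE-TABLE v1 row n02 «N02 IS A KNIT, NOT A HUNT»).  THEOREMS ONLY, def-free, sorry-free, standard axioms.
The CONVENTIONS OF RECORD block of the root module `Node00.Carriers` applies.  EVERYTHING MATHEMATICAL BELOW IS AN EXISTING KERNEL THEOREM OF
THE TREE, USED BY NAME; this file is the referee-facing ASSEMBLY in the pattern of `Node00.N01Dossier` (seat dag-p3) — YM-PLAN §1 (a)(b)(c):
the referee reads the landed file against the printed page and the node's in-edges — it re-proves nothing of Bałaban's and moves no count by
itself (the count move is the chair's booking after the referee's read, species rule R414 (B)(v) ∕ R417, director-ym №5).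

## THE NODE.  `Dag.B5_main ℓ := ℓ.b4 → ℓ.b5` (`…Balaban1983to89.Dag`, :182; «N02 · B5 cites B4 as [2]: "We will apply the methods and results of
paper [2]" (p. 17)») — ONE in-edge, `b4` ↦ N01 (`N02_iff_leaf`).  Venue statement of record `YMDAG.N02 w P := Dag.B5_main (DagBinding.leavesP w P)`
(`HOME/lean/ym-dag/N02_B5.lean` f30c92ce36611193) — DEFINITIONALLY the type proved here; the re-pointed venue slot (REPOINT-S1 kit v1.1, staged bytes
644056154b8ac305, execution Thu 2026-08-27 by the plan desk, R381) `N02_holds (w) (hw : Node00.IsWorldOfRecord₁ w) (P)` has body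
`Node00.b5_main_of_isWorldOfRecord₁ w hw P` — the theorem §1 re-exports as `N02_at_record`.  At a world of record the leaf `b5` is read at the N-binding
`DagBinding.Upstream.ofPrintedAllXPN` over the Stage-1 bundle `Node00.carriers₁ θ X`; `b5` is the SAME in the literal P-binding (`N02_leaf_b5_binding_agnostic`,
`rfl`): `b5 = B5.MainBlock fam5 forms5 := Prop11Printed fam5 ∧ Prop12Printed fam5 ∧ Bounds167 forms5` (B5.lean :584).

## IN-EDGE DISCIPLINE (YM-PLAN §1 v0.8 VACUITY GUARD, which names «N02 = b4 → b5 under an XP-bound b4» as THE known hazard).  §2 below shows,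
in kernel form, that at every world of record the in-edge `b4` HOLDS (`N02_inEdge_b4_at_record` = N01 by name) AND the node's own leaf `b5` holds
OUTRIGHT (`N02_leaf_b5_at_record`, never touching `b4`): `N02_at_record_guarded : b4 ∧ b5 ∧ (b4 → b5)`.  The in-edge is CONSUMED (trivially — [B5]'s
printed Props. 1.1–1.2 are proved in the tree without importing [B4]'s conclusions; print's «methods and results of paper [2]» are used INSIDE the
lineage proofs, e.g. the B4-dictionary `B5DictTorusEta`, not as a hypothesis of the node), never REFUTED.  §6 records the contrast: at an XP-bound
world over b04's zero-field box family the same node statement holds EX FALSO (`N02_at_XP_boxFamB_vacuous : ¬ b4 ∧ (b4 → b5)`) — NOT a discharge, not claimed.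

## LEGS TABLE (conjunct of `b5` ↔ typed decl (file) ↔ printed statement (CMP **95** (1984), journal page = PDF page + 16) ↔ family OF RECORD it is
## instantiated at (`CarriersFrame.carriers₁_groupB5` ∕ `N02_families_of_record`, `rfl`) ↔ the lineage theorem that proves it there, BY NAME) — kernel form: `N02_iff_legs`.
| # | typed conjunct | print (verbatim in the decl's docstring, B5.lean) | family of record at `θ : Stage1Params` | proved by |
|---|---|---|---|---|
| 1 | `B5.Prop11Printed fam5` (B5.lean :81: `∃ γ₀ > 0, ∀ i, (∀ n J, ‖·‖-six (1.89) ≤ γ₀⁻¹‖J‖) ∧ (∀ A, γ₀⟨A,(Δ+I)A⟩ ≤ ⟨A,Δ_aA⟩)`) | Prop. 1.1 p. 33: «The operator G is a symmetric operator on L²(T_η) and ‖GJ‖, ‖∇GJ‖, ‖G∇*J‖, ‖∇G∇*J‖, ‖∇∇GJ‖, ‖G∇*∇*J‖ ≤ γ₀^{−1}‖J‖, (1.89) with a positive constant γ₀ independent of k, T_η, and depending on d only (if we put a = 1). This implies the bound from below: Δ_a = G^{−1} ≥ γ₀(Δ + I). (1.90)» | `fam5 := B5Prop12GLattice.famG D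 L a` — index `B5ResidualGpTorusHolds.TopIdx D L` ([B5]'s TOP-LEVEL tori), member `i ↦ B5SettingP12Real.latticeSettingP12R (nP i.P) (MP i.P) a i.P.K` = the REAL `η^d`-weighted setting of `G = Δ_a⁻¹` ((1.71); every functional of (1.89)∕(1.108)–(1.114) concrete) | `B5WalkRealisationTorus.prop11Printed_famG` (lit-balaban r02∕p38; `γ₀ = gammaZero D a`) — `N02_leg_prop11` |
| 2 | `B5.Prop12Printed fam5` (B5.lean :123: `∃ δ₀ C Cα Cε Cαε, 0 < δ₀ ∧ 0 < C ∧ ∀ i, Ineq110_114 (fam i) …` = (1.110) ∧ (1.111) ∧ (1.112) ∧ (1.113) ∧ (1.114), constants chosen BEFORE the instance) | Prop. 1.2 pp. 35–36: «There exists a positive constant δ₀ depending on d only, such that |(GJ)(x)|, |(∇GJ)(x)|, |(G∇*J)(x)|, |(ΔGJ)(x)| ≤ O(1)e^{−δ₀|y−y′|}|J| (1.110) for x ∈ Δ̃(y), supp J ⊂ Δ̃(y′), … ‖ζGJ‖, …, ‖ζG∇*∇*J‖ ≤ O(1)e^{−δ₀|y−y′|}|ζ| ‖J‖ (1.114) for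 supp ζ ⊂ Δ̃(y), supp J ⊂ Δ̃(y′).» | the same `famG D L a` | `B5Prop12GHolds.prop12_famG_printed` (lit-balaban p37, via p38's (1.132)∕(1.133) assembly `B5Prop12GLattice.prop12_famG_of_local114` + `local114Fam_famG`) — `N02_leg_prop12` |
| 3 | `B5.Bounds167 forms5` (B5.lean :137: `∃ γ₀ γ₁ > 0, ∀ i B, γ₀·d1Sq B ≤ formΔk B ≤ γ₁·d1Sq B`) | (1.67) p. 29: «γ₀⟨∂₁B, ∂₁B⟩ ≤ ⟨B, Δ_kB⟩ ≤ γ₁⟨∂₁B, ∂₁B⟩, γ₀, γ₁ > 0 depending on d only.» | `forms5 := Node00.formsOfRecord D L`, member `i ↦ B5Bounds167Lattice.formOfLatticeR (nP i.P) (sitesPerDir i.P K)` — the REAL unit-torus forms, `⟨B, Δ_kB⟩` AS GIVEN BY the third expression of (1.66) | `Node00.bounds167_formsOfRecord` ⇐ `B5Bounds167Lattice.bounds167_formOfLatticeR` (pub-balaban pv15; `γ₀ = (4∕π²)^{D+2}`, `γ₁ = (π²∕4)^{2D+4}`) — `N02_leg_bounds167` |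
The constants (1.115)–(1.117) p. 36 («imply immediately») are NOT part of the leaf; they are in the tree anyway (`B5Prop12GHolds.global115_117_famG_printed`).

## LOCATED READINGS ∕ CAVEATS (verbatim species words of the lineage headers and rulings; READINGS adjudicated by the cross-read, the referee and
## the leads — cited, not re-litigated here)
* RE-INDEXING OF RECORD (R325 D2, leads' joint sitting 2026-08-24T20:00Z; cross-read XREAD-B4 v0.5 916ee200b5ee85da §9 «re-indexing WITHOUT LOSS —
  countersigned»): [B5] states Props. 1.1–1.2 at every scale `k ≤ K` of a run `(m, K)` (`η = L^{−k}`); the family of record is indexed by TOP-LEVEL tori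
  only (`k = K`), and the printed scale-`k` instance of run `(m′, K′)` is the member `(m′ + K′ − k, k)` — the same pair of lattices (`L^k` fine points per
  unit interval, `2L^{m′+K′−k}` unit sites per direction) with `Setting.k = k`; `N02_index_dictionary` is the member-side half in kernel form.
* `U = 1` (as printed: [B5] has no background field), `m² = 0` (as printed), `a > 0` any (print: «if we put a = 1»; the family parameter is `θ.a`,
  `a₋ ≤ a ≤ a₊` by `Stage1Params.Admissible`); the printed propagator `G = Δ_a⁻¹` itself («EVERY slot concrete», `B5Prop12GLattice` header);
  real sources `J`, `A` (print (1.3): real fields) with the printed `η^d`-weighted `L²(T_η)` norm (`B5SettingP12Real`).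
* PROOF ROUTES (not carrier readings): (1.114) for `G` by Combes–Thomas on the torus (`B5Local114GLattice`, p37) — print's random-walk route
  (1.118)–(1.131) is ALSO in the tree (`B5WalkRealisationTorus.local114Fam_famG_walk`, p38), same statement; (1.110)–(1.113) by the (1.132)∕(1.133)
  transfer from `G₀`; (1.126)–(1.127) proved (`B5PBridgeKernel126`), where print is «very sketchy» (p. 37, census C-B5-6).
* CONSTANTS: print's «depending on d only» silently includes the series' fixed `L` (census C-B5-5) and here also `a` (`gammaZero D a`, `const114 D a`);
  the typed predicates quantify `∃ γ₀ … ∀ i` over the family at fixed `(D, L, a)` — exactly that reading.  (1.89) ⇒ (1.90) with `γ₀` relabelled (C-B5-4,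
  `B5.lower_bound_relabelled`).  (1.67): the identity (1.65) = (1.66) is NOT certified in `B5Bounds167Lattice` (its header, «What is NOT claimed» (1));
  `formΔk` is DEFINED by the third expression of (1.66), for which (1.67) is proved with explicit `γ₀, γ₁` (print gives none).
* LOCATED NEGATIVES of [B5] in the tree, NONE touching the leaf: the printed `γ₁ = a⁻²` of p. 26 fails for large `a` (`B5.printed_gamma1_fails`,
  `B5Gamma1FailsLargeA`, census G-B5-13 — concerns (1.45), not (1.67)∕(1.89)); the first printed bars of (1.63) p. 28 (`B5Eq163PrintedBarsFail`) — a
  display inside Sect. D, not a conjunct of Props. 1.1–1.2.  GAPS v1.0 (pub-balaban-gaps, f047f86f34c2117b) locates no print-vs-typed gap for leaf `b5`.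
* SPECIES (R414 (B)(v) + director-ym №5): typed = printed in every leaf-read clause modulo the stated conventions above; nothing is flagged anew here;
  the referee (ref-C) and the leads own the words — in particular whether «top-level tori only ∕ m² = 0 ∕ U = 1» are print's (Q-N00-2; dag-lead row n02).

## WHAT THIS IS ∕ IS NOT.  IS: the kernel reading of [Balaban1984PropagatorsI]'s series-DAG statement AT THE NODE 00 OBJECTS OF RECORD (Stage 1:
`Node00.carriers₁ θ X`, admissible `θ`; p386048 cd4e9d6d779c `CarriersB5`, p393613 e0c4e5317ee3 `Carriers`), stable under the Stage-2 pin (p394343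
a0c530480bab), the Stage-3 pin (p404803) and the one-level B6 side pin, with the B5 index inhabited, the support antecedents of (1.110)–(1.114) met by
non-zero sources and cut-offs, worlds of record existing at Stages 1 and 3 (§5), and the in-edge consumed with a true antecedent (§2).  IS NOT: a proof
of anything about nodes N01 (beyond citing it as the in-edge), N03–N28, the construction `w.C` (Stage 5), the continuum limit, ℝ⁴, infinite volume,
OS axioms, a mass gap or the Clay problem.  One finite four-torus programme at fixed ε ([Balaban1989LargeFieldII] Thm 1 scope); a world of record with
physical dimension `D = 4` exists (§5).

EDITION 2026-08-29 (director-ym №268 (4), SECOND RING of the record-abelian repair FLAG №14): the ∃-witness literal of `N02_worldOfRecord₃_exists` re-keyed from the scalar placeholder `𝔸 := ℂ` to the record carrier `𝔸 := Matrix (Fin 2) (Fin 2) ℂ` (C⋆-structure `B10Eq29TubeLine.cstarAlgebraMatrix 2`, the carrier of `Node00.stage3OfRecord₁₂` since the FLAG №14 edition of `Node00.Record12Numerics`); the proofs are carrier-blind and NO statement changes (none of them exposes `𝔸`); one import added (`B10Eq29TubeLine`, cycle-free); count-neutral bookkeeping, nothing continuum ∕ OS ∕ mass-gap.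
-/

noncomputable section

namespace Literature.MathematicalPhysics.QuantumFieldTheory.Balaban1983to89.Node00

open scoped Matrix
open DagBinding DagDischargedII
open B5 (Prop11Printed Prop12Printed Bounds167 MainBlock)
open B5ResidualGpTorusHolds (TopIdx)
open B5Prop12GLattice (famG)
open B5SiteBridgeP12 (nP MP one_le_nP sitesPerDir_K_eq)
open B5SettingP12Real (latticeSettingP12R LocR)
open B5Bounds167Lattice (formOfLatticeR)
open B5WalkRealisationTorus (prop11Printed_famG)
open B5Prop12GHolds (prop12_famG_printed)
open B5Prop12FieldsLattice (toFine toFine_mem_cubeT cubeT suppInL supNormL cutInL cutSupL)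
open LatticeNorms (supNorm supNorm_le norm_le_supNorm)

/-! ## §0. The node statement and its ONE in-edge -/

/-- **N02 has exactly one in-edge**: `Dag.B5_main ℓ` IS `ℓ.b4 → ℓ.b5` (`Iff.rfl`) — [Balaban1984PropagatorsI] cites [Balaban1983RegularityDecay] as [2]
(«We will apply the methods and results of paper [2]», p. 17); the producing node of `b4` is N01. [cite: Balaban1984PropagatorsI, p.17 (the citation sentence), Props. 1.1–1.2 pp.33–36 (the node's content; bookkeeping)] -/
theorem N02_iff_leaf (ℓ : Dag.Leaves) : Dag.B5_main ℓ ↔ (ℓ.b4 → ℓ.b5) :=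
  Iff.rfl

/-- The node from its OWN leaf alone: a proof of `b5` outright gives N02 at any leaves assignment (the in-edge is then consumed trivially — this is
the shape of every discharge below; nothing is derived FROM `b4`). [cite: Balaban1984PropagatorsI, Props. 1.1–1.2 pp.33–36 (bookkeeping)] -/
theorem N02_of_leaf_b5 (ℓ : Dag.Leaves) (h : ℓ.b5) : Dag.B5_main ℓ :=
  fun _ => h

/-- **The leaf `b5` is BINDING-AGNOSTIC**: the literal P-binding `Upstream.ofPrintedAllXP` and the N-binding of record `Upstream.ofPrintedAllXPN` carry
the SAME `b5 = B5.MainBlock X.fam5 X.forms5` (`rfl`; the two bindings differ in `b4` only).  So, unlike N01, no «XP vs XPN» reading question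
exists for N02's own leaf. [cite: Balaban1984PropagatorsI, Props. 1.1–1.2 pp.33–36, (1.67) p.29 (dictionary, bookkeeping)] -/
theorem N02_leaf_b5_binding_agnostic (X : PrintedCarriersR) (Y : PrintedCarriers9X) (Z : PrintedCarriers11) (V : PrintedCarriers14R)
    (W : PrintedCarriers15) :
    (Upstream.ofPrintedAllXPN X Y Z V W).b5 = (Upstream.ofPrintedAllXP X Y Z V W).b5 ∧
      (Upstream.ofPrintedAllXPN X Y Z V W).b5 = MainBlock X.fam5 X.forms5 :=
  ⟨rfl, rfl⟩

/-! ## §1. THE NODE AT THE WORLDS OF RECORD, BY NAME (Stage 1; stable under the Stage-2, Stage-3 and one-level-B6 pins) -/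

/-- **N02 · [Balaban1984PropagatorsI] AT EVERY NODE 00 WORLD OF RECORD (Stage 1), EVERY RUN** — `∀ w, IsWorldOfRecord₁ w → ∀ P, Dag.B5_main (leavesP w P)`
(venue: `YMDAG.N02 w P`), the root's `b5_main_of_isWorldOfRecord₁` BY NAME (p393613 e0c4e5317ee3).  Hypotheses: the world-of-record predicate only
(no named fact; the in-edge `b4` is not used — and HOLDS there, §2). [cite: Balaban1984PropagatorsI, Prop. 1.1 (1.89)–(1.90) p.33, Prop. 1.2 (1.110)–(1.114) pp.35–36, (1.67) p.29 — kernel versions of the lit-balaban lineages at the objects of record] -/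
theorem N02_at_record : ∀ w : WorldP, IsWorldOfRecord₁ w → ∀ P : B12.RunParams, Dag.B5_main (leavesP w P) :=
  fun w hw P => b5_main_of_isWorldOfRecord₁ w hw P

/-- **N02 at every world of record, Stage 2** (the [Balaban1985Averaging] group pinned as well; `IsWorldOfRecord₂ → IsWorldOfRecord₁`, `Node00.Carriers2`
p394343 a0c530480bab) — the discharge is STABLE under the later pin. [cite: Balaban1984PropagatorsI, Props. 1.1–1.2 pp.33–36, (1.67) p.29 — kernel versions at the objects of record, Stage 2] -/
theorem N02_at_record₂ : ∀ w : WorldP, IsWorldOfRecord₂ w → ∀ P : B12.RunParams, Dag.B5_main (leavesP w P) :=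
  fun w hw P => b5_main_of_isWorldOfRecord₂ w hw P

/-- **N02 at every world of record, Stage 3** (the k-level [Balaban1984PropagatorsII] block pinned as well; `IsWorldOfRecord₃ → IsWorldOfRecord₂ → IsWorldOfRecord₁`,
`Node00.Carriers3` p404803) — the CURRENT NODE 00 stage; stable. [cite: Balaban1984PropagatorsI, Props. 1.1–1.2 pp.33–36, (1.67) p.29 — kernel versions at the objects of record, Stage 3] -/
theorem N02_at_record₃ : ∀ w : WorldP, IsWorldOfRecord₃ w → ∀ P : B12.RunParams, Dag.B5_main (leavesP w P) :=
  fun w hw P => b5_main_of_isWorldOfRecord₃ w hw P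

/-- **N02 at every world of the ONE-LEVEL B6 side reading** (`IsWorldOfRecord₁OL → IsWorldOfRecord₁`, root §5) — stable under that side pin too.
[cite: Balaban1984PropagatorsI, Props. 1.1–1.2 pp.33–36, (1.67) p.29 — kernel versions at the objects of record] -/
theorem N02_at_record₁OL : ∀ w : WorldP, IsWorldOfRecord₁OL w → ∀ P : B12.RunParams, Dag.B5_main (leavesP w P) :=
  fun w hw P => b5_main_of_isWorldOfRecord₁ w (isWorldOfRecord₁_of_isWorldOfRecord₁OL w hw) P

/-! ## §2. THE VACUITY GUARD IN KERNEL FORM: at a world of record the in-edge `b4` HOLDS (it is CONSUMED, never refuted) and the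
## node's OWN leaf `b5` holds OUTRIGHT — the discharge is not an ex-falso instance of «b4 → b5» -/

/-- **The in-edge at the worlds of record**: the leaf `b4` of the run (= `Dag.B4_main (leavesP w P)`, node N01) HOLDS at every world of record, Stage 1
(`b4_main_of_isWorldOfRecord₁`, dossier `Node00.N01_at_record`).  Hence the implication «b4 → b5» is discharged with a TRUE antecedent. [cite: Balaban1983RegularityDecay, Theorem p.573 (0 ≤ α form), Props. 2.3 / 3.1′ p.574, Sect. 5 Theorem p.594 — kernel versions of the lit-balaban r01 lineage (the in-edge)] -/
theorem N02_inEdge_b4_at_record (w : WorldP) (hw : IsWorldOfRecord₁ w) (P : B12.RunParams) : (leavesP w P).b4 :=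
  b4_main_of_isWorldOfRecord₁ w hw P

/-- **The node's own leaf OUTRIGHT**: `b5 = B5.MainBlock` (Prop. 1.1 ∧ Prop. 1.2 ∧ (1.67)) of the run HOLDS at every world of record, Stage 1 — by the
root's `carriers₁_b5` (⇐ `b5_withB5OfRecord` ⇐ the three lineage theorems), WITHOUT touching `b4`. [cite: Balaban1984PropagatorsI, Prop. 1.1 p.33, Prop. 1.2 pp.35–36, (1.67) p.29 — kernel versions of the lit-balaban lineages at the objects of record] -/
theorem N02_leaf_b5_at_record (w : WorldP) (hw : IsWorldOfRecord₁ w) (P : B12.RunParams) : (leavesP w P).b5 := by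
  obtain ⟨θ, hθ, hup⟩ := hw
  obtain ⟨X, Y, Z, V, W, hP⟩ := hup P
  show (w.up P).b5
  rw [hP]
  exact carriers₁_b5 θ hθ X Y Z V W

/-- **Guard summary**: at every world of record, every run, antecedent AND consequent AND node hold together — `b4 ∧ b5 ∧ (b4 → b5)`.  A referee checking
«in-edge hypotheses CONSUMED, not refuted» (YM-PLAN §1 vacuity guard) reads it off this conjunction. [cite: Balaban1983RegularityDecay, Theorem p.573; Balaban1984PropagatorsI, Props. 1.1–1.2 pp.33–36 (bookkeeping over the lineages' theorems)] -/
theorem N02_at_record_guarded (w : WorldP) (hw : IsWorldOfRecord₁ w) (P : B12.RunParams) :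
    (leavesP w P).b4 ∧ (leavesP w P).b5 ∧ Dag.B5_main (leavesP w P) :=
  ⟨N02_inEdge_b4_at_record w hw P, N02_leaf_b5_at_record w hw P, N02_at_record w hw P⟩

/-- At a world of record the node statement is EQUIVALENT to its own leaf (the antecedent being true there): `Dag.B5_main (leavesP w P) ↔ (leavesP w P).b5`.
[cite: Balaban1984PropagatorsI, Props. 1.1–1.2 pp.33–36 (bookkeeping)] -/
theorem N02_iff_leaf_b5_at_record (w : WorldP) (hw : IsWorldOfRecord₁ w) (P : B12.RunParams) :
    Dag.B5_main (leavesP w P) ↔ (leavesP w P).b5 :=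
  ⟨fun h => h (N02_inEdge_b4_at_record w hw P), fun h _ => h⟩

/-! ## §3. THE THREE LEGS IN KERNEL FORM: the node at a run of a world of record UNFOLDS to Prop. 1.1 ∧ Prop. 1.2 ∧ (1.67) at the
## families of record, and each leg is the lineage's theorem BY NAME -/

section Legs

variable (θ : Stage1Params)

/-- **Leg 1 — Proposition 1.1 (1.89)–(1.90) p. 33 AT THE G-FAMILY OF RECORD** `famG D L a` (the propagator `G = Δ_a⁻¹` of (1.71) on [B5]'s top-level tori, r02's
real weighted setting `latticeSettingP12R`): `B5WalkRealisationTorus.prop11Printed_famG` by name, `γ₀ = gammaZero D a` (consumes `a > 0` of `θ.Admissible`).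
[cite: Balaban1984PropagatorsI, Prop. 1.1 (1.89)–(1.90) p.33] -/
theorem N02_leg_prop11 (hθ : θ.Admissible) : Prop11Printed (famG θ.D θ.L θ.a) := by
  obtain ⟨_, _, _, _, _, ha0, _⟩ := hθ
  exact prop11Printed_famG θ.D θ.L ha0

/-- **Leg 2 — Proposition 1.2 (1.110)–(1.114) pp. 35–36 AT THE G-FAMILY OF RECORD**: `B5Prop12GHolds.prop12_famG_printed` by name (consumes `D ≥ 1` — from
`D ≥ 2` —, `L` odd `> 1`, `a > 0`). [cite: Balaban1984PropagatorsI, Prop. 1.2 (1.110)–(1.114) pp.35–36] -/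
theorem N02_leg_prop12 (hθ : θ.Admissible) : Prop12Printed (famG θ.D θ.L θ.a) := by
  obtain ⟨hD, _, _, _, _, ha0, _⟩ := hθ
  exact prop12_famG_printed (le_trans one_le_two hD) θ.hL ha0

/-- **Leg 3 — (1.67) p. 29 AT THE FORM FAMILY OF RECORD** `formsOfRecord D L` (real unit-torus forms `⟨B, Δ_kB⟩`, `⟨∂₁B, ∂₁B⟩`): `bounds167_formsOfRecord` (⇐ pv15's
`B5Bounds167Lattice.bounds167_formOfLatticeR`, `γ₀ = (4/π²)^{D+2}`, `γ₁ = (π²/4)^{2D+4}`) by name — no hypothesis. [cite: Balaban1984PropagatorsI, (1.67) p.29] -/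
theorem N02_leg_bounds167 : Bounds167 (formsOfRecord θ.D θ.L) :=
  bounds167_formsOfRecord θ.D θ.L

variable (X : PrintedCarriersR) (Y : PrintedCarriers9X) (Z : PrintedCarriers11) (V : PrintedCarriers14R) (W : PrintedCarriers15)
  (w : WorldP) (P : B12.RunParams)

/-- **THE LEGS TABLE, KERNEL FORM.**  At a run `P` of a world whose upstream block is the N-binding over the Stage-1 bundle of record `carriers₁ θ X`, the node
statement `Dag.B5_main (leavesP w P)` (venue `YMDAG.N02 w P`) IS — `Iff`, by unfolding only — «the run's `b4` leaf → Prop. 1.1 at `famG D L a` ∧ Prop. 1.2 at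
`famG D L a` ∧ (1.67) at `formsOfRecord D L`».  Nothing hides behind the binding. [cite: Balaban1984PropagatorsI, Prop. 1.1 (1.89)–(1.90) p.33, Prop. 1.2 (1.110)–(1.114) pp.35–36, (1.67) p.29 (dictionary: what the node asserts at the objects of record)] -/
theorem N02_iff_legs (hP : w.up P = Upstream.ofPrintedAllXPN (carriers₁ θ X) Y Z V W) :
    Dag.B5_main (leavesP w P) ↔
      ((Upstream.ofPrintedAllXPN (carriers₁ θ X) Y Z V W).b4 →
        Prop11Printed (famG θ.D θ.L θ.a) ∧ Prop12Printed (famG θ.D θ.L θ.a) ∧ Bounds167 (formsOfRecord θ.D θ.L)) :=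
  b5_main_iff_of_up hP

/-- **… with the in-edge discharged** (admissible `θ`: the run's `b4` leaf holds, `carriers₁_b4`): the node statement at the run IS the conjunction of the three
printed statements at the families of record. [cite: Balaban1984PropagatorsI, Prop. 1.1 p.33, Prop. 1.2 pp.35–36, (1.67) p.29 (dictionary, in-edge consumed)] -/
theorem N02_iff_legs_of_admissible (hθ : θ.Admissible) (hP : w.up P = Upstream.ofPrintedAllXPN (carriers₁ θ X) Y Z V W) :
    Dag.B5_main (leavesP w P) ↔
      Prop11Printed (famG θ.D θ.L θ.a) ∧ Prop12Printed (famG θ.D θ.L θ.a) ∧ Bounds167 (formsOfRecord θ.D θ.L) := by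
  rw [N02_iff_legs θ X Y Z V W w P hP]
  exact ⟨fun h => h (carriers₁_b4 θ hθ X Y Z V W), fun h _ => h⟩

/-- **The node at the run FROM THE THREE LEGS** (intro form): a proof of N02 at a world of record consumes exactly Prop. 1.1, Prop. 1.2 and (1.67) at the
families of record — no named fact, no placeholder, nothing derived from the in-edge. [cite: Balaban1984PropagatorsI, Prop. 1.1 p.33, Prop. 1.2 pp.35–36, (1.67) p.29 (assembly; bookkeeping)] -/
theorem N02_of_legs (hP : w.up P = Upstream.ofPrintedAllXPN (carriers₁ θ X) Y Z V W) (h₁ : Prop11Printed (famG θ.D θ.L θ.a))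
    (h₂ : Prop12Printed (famG θ.D θ.L θ.a)) (h₃ : Bounds167 (formsOfRecord θ.D θ.L)) : Dag.B5_main (leavesP w P) :=
  (N02_iff_legs θ X Y Z V W w P hP).2 fun _ => ⟨h₁, h₂, h₃⟩

/-- **The node at the run, assembled LEG BY LEG from the three lineage theorems** (a second proof of `b5_main_of_isWorldOfRecord₁`'s content at the run, routed
through the table). [cite: Balaban1984PropagatorsI, Prop. 1.1 p.33, Prop. 1.2 pp.35–36, (1.67) p.29 — kernel versions of the lit-balaban lineages, assembled] -/
theorem N02_at_run (hθ : θ.Admissible) (hP : w.up P = Upstream.ofPrintedAllXPN (carriers₁ θ X) Y Z V W) :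
    Dag.B5_main (leavesP w P) :=
  N02_of_legs θ X Y Z V W w P hP (N02_leg_prop11 θ hθ) (N02_leg_prop12 θ hθ) (N02_leg_bounds167 θ)

/-- **The table at Stage 2**: over `carriers₂ θ₂ X = carriers₁ θ₂.toStage1Params (withB7OfRecord X D L 𝔸)` the node unfolds to the SAME three printed statements
at the SAME B5 families of record (the [Balaban1985Averaging] pin does not touch the B5 group). [cite: Balaban1984PropagatorsI, Props. 1.1–1.2 pp.33–36, (1.67) p.29 (dictionary, Stage 2)] -/
theorem N02_iff_legs₂ (θ₂ : Stage2Params) (hP : w.up P = Upstream.ofPrintedAllXPN (carriers₂ θ₂ X) Y Z V W) :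
    Dag.B5_main (leavesP w P) ↔
      ((Upstream.ofPrintedAllXPN (carriers₂ θ₂ X) Y Z V W).b4 →
        Prop11Printed (famG θ₂.D θ₂.L θ₂.a) ∧ Prop12Printed (famG θ₂.D θ₂.L θ₂.a) ∧ Bounds167 (formsOfRecord θ₂.D θ₂.L)) :=
  N02_iff_legs θ₂.toStage1Params (withB7OfRecord X θ₂.D θ₂.L θ₂.𝔸) Y Z V W w P hP

/-- **The table at Stage 3** (the current NODE 00 stage): over `carriers₃ θ₃ X` the node unfolds to the SAME three printed statements at the SAME B5 families
of record (the k-level [Balaban1984PropagatorsII] pin does not touch the B5 group). [cite: Balaban1984PropagatorsI, Props. 1.1–1.2 pp.33–36, (1.67) p.29 (dictionary, Stage 3)] -/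
theorem N02_iff_legs₃ (θ₃ : Stage3Params) (hP : w.up P = Upstream.ofPrintedAllXPN (carriers₃ θ₃ X) Y Z V W) :
    Dag.B5_main (leavesP w P) ↔
      ((Upstream.ofPrintedAllXPN (carriers₃ θ₃ X) Y Z V W).b4 →
        Prop11Printed (famG θ₃.D θ₃.L θ₃.a) ∧ Prop12Printed (famG θ₃.D θ₃.L θ₃.a) ∧ Bounds167 (formsOfRecord θ₃.D θ₃.L)) :=
  N02_iff_legs θ₃.toStage1Params (withB7OfRecord (withB6KOfRecord X θ₃) θ₃.D θ₃.L θ₃.𝔸) Y Z V W w P hP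

end Legs

/-! ## §4. THE FAMILIES OF RECORD, FIELD BY FIELD, and the RE-INDEXING DICTIONARY (R325 D2: [B5]'s scale-k statement of the run (m, K) is read at the
## top level of the run (m + K − k, k) — «re-indexing WITHOUT LOSS», cross-read XREAD-B4 v0.5 §9) -/

/-- **What the B5 group of `carriers₁ θ X` IS** (`rfl`): index = [B5]'s top-level tori `TopIdx D L`; at the torus `i` the setting is r02's REAL weighted setting of
record `latticeSettingP12R (nP i.P) (MP i.P) a i.P.K` of `G = Δ_a⁻¹` (every functional of (1.89)/(1.108)–(1.114) concrete) and the form datum is pv15's real unit-torus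
form carrier `formOfLatticeR (nP i.P) (sitesPerDir i.P K)`. [cite: Balaban1984PropagatorsI, (1.64)–(1.71) pp.29–30, Prop. 1.1 p.33, Prop. 1.2 pp.35–36 (dictionary, bookkeeping)] -/
theorem N02_families_of_record (θ : Stage1Params) (X : PrintedCarriersR) :
    (carriers₁ θ X).I5 = TopIdx θ.D θ.L ∧
    (carriers₁ θ X).fam5 = (fun i : TopIdx θ.D θ.L => latticeSettingP12R (nP i.P) (MP i.P) θ.a i.P.K) ∧
    (carriers₁ θ X).forms5 =
      (fun i : TopIdx θ.D θ.L => formOfLatticeR (d := θ.D) (nP i.P) (fun _ : Fin θ.D => i.P.sitesPerDir i.P.K)) :=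
  ⟨rfl, rfl, rfl⟩

/-- **The re-indexing dictionary of a member** `i : TopIdx D L`: its torus parameters have `d = D`, block size `L`, top scale `K ≥ 1`; the fine lattice has
`nP = L^K` points per unit interval (`η = L^{−K}`) and the unit lattice `T₁^{(K)}` has `MP_μ = 2·L^m = sitesPerDir K` sites in every direction — i.e. the member
(m, K) is EXACTLY the printed scale-`k = K` instance of Props. 1.1–1.2 on the torus of run (m, K); the printed scale-k instance of a run (m′, K′) with k ≤ K′ is the
member (m′ + K′ − k, k). [cite: Balaban1984PropagatorsI, (1.1)–(1.6) pp.18–19 (the lattices T^{(k)}_η, T₁^{(k)}); Balaban1987RG1, (0.1) p.251 (L, m, K) — dictionary, bookkeeping] -/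
theorem N02_index_dictionary {D L : ℕ} (i : TopIdx D L) :
    i.P.d = D ∧ i.P.L = L ∧ 1 ≤ i.P.K ∧ nP i.P = L ^ i.P.K ∧ (∀ μ, MP i.P μ = 2 * L ^ i.P.m) ∧
      ∀ μ, i.P.sitesPerDir i.P.K = MP i.P μ := by
  obtain ⟨P, hPd, hPL, hK⟩ := i
  subst hPd
  subst hPL
  exact ⟨rfl, rfl, hK, rfl, fun _ => rfl, fun μ => sitesPerDir_K_eq P μ⟩

/-! ## §5. NON-VACUITY, BY NAME: worlds of record exist at every stage (with `D = 4` at Stage 1), the B5 index of record is inhabited, and the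
## support antecedents of (1.110)–(1.114) are met by NON-ZERO sources and cut-offs (so no printed inequality is read over an empty range) -/

/-- **There IS a world of record, and the node holds at it** (Stage 1; the root's `exists_admissible` + `Node00.Satisfiable.exists_isWorldOfRecord₁`).
[cite: Balaban1984PropagatorsI, (1.1)–(1.6) pp.18–19 (objects of record; bookkeeping)] -/
theorem N02_worldOfRecord_exists : ∃ w : WorldP, IsWorldOfRecord₁ w ∧ ∀ P : B12.RunParams, Dag.B5_main (leavesP w P) := by
  obtain ⟨w, _, _, _, _, hw⟩ := exists_isWorldOfRecord₁
  exact ⟨w, hw, fun P => b5_main_of_isWorldOfRecord₁ w hw P⟩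

/-- **… in the physical dimension**: a world of record whose family parameters have `D = 4` ([B5]'s tori are `D`-dimensional: `d := D` in `carriers₁`; the one
finite FOUR-torus programme), with the node at every run. [cite: Balaban1984PropagatorsI, (1.1)–(1.6) pp.18–19 (objects of record, D = 4 witness; bookkeeping)] -/
theorem N02_worldOfRecord_exists_dim4 :
    ∃ (w : WorldP) (θ : Stage1Params), θ.Admissible ∧ θ.D = 4 ∧
      (∀ P : B12.RunParams, ∃ (X : PrintedCarriersR) (Y : PrintedCarriers9X) (Z : PrintedCarriers11) (V : PrintedCarriers14R)
        (W : PrintedCarriers15), w.up P = Upstream.ofPrintedAllXPN (carriers₁ θ X) Y Z V W) ∧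
      ∀ P : B12.RunParams, Dag.B5_main (leavesP w P) := by
  obtain ⟨w, θ, hθ, hD, hup, hw⟩ := exists_isWorldOfRecord₁
  exact ⟨w, θ, hθ, hD, hup, fun P => b5_main_of_isWorldOfRecord₁ w hw P⟩

/-- **Stage-3 worlds of record EXIST, and the node holds at them** — `IsWorldOfRecord₃` (the current NODE 00 stage, `Node00.Carriers3`) is satisfiable: any
admissible Stage-1 parameter family extends to Stage 3 (coefficient algebra `M₂(ℂ)` — the record carrier `Matrix (Fin 2) (Fin 2) ℂ` (EDITION director-ym №268 (4), second ring: formerly the scalar placeholder `ℂ`); torus dimension index `D − 1`, block index `L − 1`, band `b₀ = b₁ = 1`, rate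
`δ₀ = 2/L`), the un-pinned bundles degenerate (`Node00.Satisfiable` §1).  So `N02_at_record₃` does not quantify over an empty class. [cite: Balaban1984PropagatorsII, (2.1)–(2.4) p.224, (2.16) p.225 (Stage-3 parameter dictionary); Balaban1984PropagatorsI, Props. 1.1–1.2 pp.33–36 — bookkeeping] -/
theorem N02_worldOfRecord₃_exists : ∃ w : WorldP, IsWorldOfRecord₃ w ∧ ∀ P : B12.RunParams, Dag.B5_main (leavesP w P) := by
  obtain ⟨θ, hθ, -⟩ := Stage1Params.exists_admissible
  obtain ⟨X⟩ := nonempty_printedCarriersR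
  obtain ⟨Y⟩ := nonempty_printedCarriers9X
  obtain ⟨Z⟩ := nonempty_printedCarriers11
  obtain ⟨V⟩ := nonempty_printedCarriers14R
  obtain ⟨W⟩ := nonempty_printedCarriers15
  obtain ⟨w⟩ := nonempty_worldP
  have hD : 1 ≤ θ.D := le_trans one_le_two hθ.1
  have hL : 1 ≤ θ.L := le_of_lt θ.hL.2
  let θ₃ : Stage3Params :=
    { θ with
      𝔸 := Matrix (Fin 2) (Fin 2) ℂ, instCStar := B10Eq29TubeLine.cstarAlgebraMatrix 2, instNontrivial := inferInstance, d₆ := θ.D - 1, ℓ₆ := θ.L - 1, hd₆ := Nat.sub_add_cancel hD, hℓ₆ := Nat.sub_add_cancel hL, b₀ := 1, b₁ := 1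
      hb := ⟨one_pos, le_rfl⟩, δ₀ := 2 / (((θ.L - 1 : ℕ) : ℝ) + 1), hδ₀ := ⟨by positivity, le_rfl⟩ }
  have hw₃ : IsWorldOfRecord₃ (WorldP.withUp w fun _ => Upstream.ofPrintedAllXPN (carriers₃ θ₃ X) Y Z V W) :=
    isWorldOfRecord₃_of_up θ₃ hθ X Y Z V W _ rfl
  exact ⟨_, hw₃, fun P => b5_main_of_isWorldOfRecord₃ _ hw₃ P⟩

/-- **At every world of record and every run, the node holds ON A NON-EMPTY FAMILY**: the upstream block is the N-binding over some `carriers₁ θ X` (admissible `θ`)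
whose B5 index `I5 = TopIdx D L` is INHABITED (and so are the in-edge's three B4 index types) — `Node00.NonVacuityTheta.nonempty_indices₁_of_admissible`; the leaf
`B5.MainBlock` has no instance-level antecedent beyond the index (vacuity standard Q-N00-6). [cite: Balaban1984PropagatorsI, (1.1)–(1.6) pp.18–19, Props. 1.1–1.2 pp.33–36 (bookkeeping over the lineage's non-vacuity lemmas)] -/
theorem N02_at_record_nonvacuous (w : WorldP) (hw : IsWorldOfRecord₁ w) (P : B12.RunParams) :
    Dag.B5_main (leavesP w P) ∧
    ∃ (θ : Stage1Params) (X : PrintedCarriersR) (Y : PrintedCarriers9X) (Z : PrintedCarriers11) (V : PrintedCarriers14R)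
      (W : PrintedCarriers15), θ.Admissible ∧ w.up P = Upstream.ofPrintedAllXPN (carriers₁ θ X) Y Z V W ∧
      Nonempty (carriers₁ θ X).I5 ∧
      (Nonempty (carriers₁ θ X).I4E ∧ Nonempty (carriers₁ θ X).I4U ∧ Nonempty (carriers₁ θ X).I4F) := by
  refine ⟨b5_main_of_isWorldOfRecord₁ w hw P, ?_⟩
  obtain ⟨θ, hθ, hup⟩ := hw
  obtain ⟨X, Y, Z, V, W, hP⟩ := hup P
  obtain ⟨hE, hU, hF, h5⟩ := nonempty_indices₁_of_admissible θ hθ X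
  exact ⟨θ, X, Y, Z, V, W, hθ, hP, h5, hE, hU, hF⟩

/-- **The support antecedent «supp J ⊂ Δ̃(y′)» of (1.110)–(1.114) is met by NON-ZERO sources**: in every member of the G-family of record (`D ≥ 1`), for every
unit-lattice point `y′` there is a source `J` with `supp J ⊂ Δ̃(y′)` and `|J| = 1` (the unit vector field at the bond `(n·y′, e₀)`; `n·y′ ∈ Δ̃(y′)` by
`toFine_mem_cubeT`).  So (1.110) etc. are read over NON-TRIVIAL instances at the objects of record. [cite: Balaban1984PropagatorsI, Prop. 1.2 (1.110) p.35 («supp J ⊂ Δ̃(y′)»), (1.108) p.35 (|J|) — bookkeeping over the lineage's carriers] -/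
theorem N02_sources_nondegenerate {D L : ℕ} (hD : 1 ≤ D) (a : ℝ) (i : TopIdx D L) (y' : (famG D L a i).Site) :
    ∃ J : (famG D L a i).Loc, (famG D L a i).suppIn J y' ∧ (famG D L a i).supNorm J = 1 := by
  classical
  obtain ⟨P, hPd, hPL, hK⟩ := i
  subst hPd
  let b₀ : B5Prop11Plancherel.Tor (B5Prop11Plancherel.fine (nP P) (MP P)) × Fin P.d := (toFine (nP P) (MP P) y', ⟨0, hD⟩)
  refine ⟨LocR.vec (fun b => if b = b₀ then 1 else 0), ?_, ?_⟩
  · intro b hb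
    by_cases h : b = b₀
    · subst h
      exact toFine_mem_cubeT y'
    · exact absurd (by simp [h]) hb
  · show supNorm Finset.univ (fun b => (((if b = b₀ then (1 : ℝ) else 0) : ℝ) : ℂ)) = 1
    refine le_antisymm (supNorm_le zero_le_one fun b _ => ?_) ?_
    · by_cases h : b = b₀
      · simp [h]
      · simp [h]
    · calc (1 : ℝ) = ‖(((if b₀ = b₀ then (1 : ℝ) else 0) : ℝ) : ℂ)‖ := by simp
        _ ≤ supNorm Finset.univ (fun b => (((if b = b₀ then (1 : ℝ) else 0) : ℝ) : ℂ)) :=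
          norm_le_supNorm (fun b => (((if b = b₀ then (1 : ℝ) else 0) : ℝ) : ℂ)) (Finset.mem_univ b₀)

/-- **The cut-off antecedent «supp ζ ⊂ Δ̃(y)» of (1.111), (1.113), (1.114) is met by NON-ZERO cut-offs**: in every member of the G-family of record, for every `y`
there is `ζ` with `supp ζ ⊂ Δ̃(y)` and `|ζ| = 1` (the indicator of the fine site `n·y`). [cite: Balaban1984PropagatorsI, Prop. 1.2 (1.111) p.35, (1.114) p.36 («supp ζ ⊂ Δ̃(y)») — bookkeeping over the lineage's carriers] -/
theorem N02_cutoffs_nondegenerate {D L : ℕ} (a : ℝ) (i : TopIdx D L) (y : (famG D L a i).Site) :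
    ∃ ζ : (famG D L a i).Cut, (famG D L a i).cutIn ζ y ∧ (famG D L a i).cutSup ζ = 1 := by
  classical
  obtain ⟨P, hPd, hPL, hK⟩ := i
  subst hPd
  let x₀ : B5Prop11Plancherel.Tor (B5Prop11Plancherel.fine (nP P) (MP P)) := toFine (nP P) (MP P) y
  refine ⟨fun x => if x = x₀ then 1 else 0, ?_, ?_⟩
  · intro x hx
    by_cases h : x = x₀
    · subst h
      exact toFine_mem_cubeT y
    · exact absurd (by simp [h]) hx
  · show supNorm Finset.univ (fun x => if x = x₀ then (1 : ℝ) else 0) = 1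
    refine le_antisymm (supNorm_le zero_le_one fun x _ => ?_) ?_
    · by_cases h : x = x₀
      · simp [h]
      · simp [h]
    · calc (1 : ℝ) = ‖(if x₀ = x₀ then (1 : ℝ) else 0)‖ := by simp
        _ ≤ supNorm Finset.univ (fun x => if x = x₀ then (1 : ℝ) else 0) :=
          norm_le_supNorm (fun x => if x = x₀ then (1 : ℝ) else 0) (Finset.mem_univ x₀)

/-! ## §6. WHAT THIS IS NOT: at a world bound by the LITERAL P-binding over b04's zero-field box family the SAME node statement holds — but
## only VACUOUSLY (its in-edge `b4` is FALSE there, `Node00.not_N01_at_XP_boxFamB`); that is the ex-falso «proof» the vacuity guard of YM-PLAN §1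
## excludes, and it is NOT what §1–§3 do (there `b4` holds and `b5` is proved outright) -/

/-- **The XP hazard, for N02.**  If a world's upstream block at the run is the literal P-binding `Upstream.ofPrintedAllXP` over carriers whose η-family is b04's
zero-field box family `boxFamB`, then the run's in-edge leaf `b4` is FALSE (`Node00.not_N01_at_XP_boxFamB` ← `B4Thm19ZeroBoxNegAlpha`, the typed «∀ α < 1» at
α < 0) and CONSEQUENTLY `Dag.B5_main (leavesP w P)` holds there EX FALSO, whatever the B5 group of `X` is.  Such an instance is booked against the PRODUCING node
(r∕28, N01-as-literally-typed), never as a discharge of N02 (YM-PLAN §1 v0.8 vacuity guard names exactly «N02 = b4 → b5 under an XP-bound b4»).  Recorded here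
so that the referee can see the difference in kernel form: §2's `N02_at_record_guarded` has a TRUE antecedent. [cite: Balaban1983RegularityDecay, Theorem p.573, case A = 0 (kernel refutation of the literal typed range «α < 1»); Balaban1984PropagatorsI, Props. 1.1–1.2 (bookkeeping: the vacuous instance, NOT claimed)] -/
theorem N02_at_XP_boxFamB_vacuous (X : PrintedCarriersR) (Y : PrintedCarriers9X) (Z : PrintedCarriers11) (V : PrintedCarriers14R)
    (W : PrintedCarriers15) {d ℓ : ℕ} {m2plus : ℝ} (hℓ : 1 ≤ ℓ) (hm2 : 0 ≤ m2plus) {a : ℝ} (ha : 0 < a) {Mb : ℕ} (hMb : 1 ≤ Mb)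
    (g : ∀ i : B4Cor23ZeroEta.ZeroFieldInstance d, (↥i.R → ℝ) → ℝ) (w : WorldP) (P : B12.RunParams)
    (hP : w.up P = Upstream.ofPrintedAllXP (X.withBoxFamE d ℓ m2plus a Mb g) Y Z V W) :
    ¬ (leavesP w P).b4 ∧ Dag.B5_main (leavesP w P) :=
  have h : ¬ (leavesP w P).b4 := not_N01_at_XP_boxFamB X Y Z V W hℓ hm2 ha hMb g w P hP
  ⟨h, fun hb4 => absurd hb4 h⟩

/-- **… whereas at the worlds of record no such instance exists**: the in-edge is never false there (`N02_inEdge_b4_at_record`), so EVERY proof of N02 at a world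
of record — in particular `N02_at_record` — is a proof with a satisfiable (indeed satisfied) antecedent. [cite: Balaban1983RegularityDecay, Theorem p.573 (0 ≤ α form, the in-edge of record); Balaban1984PropagatorsI, Props. 1.1–1.2 (bookkeeping)] -/
theorem N02_no_exFalso_at_record (w : WorldP) (hw : IsWorldOfRecord₁ w) (P : B12.RunParams) : ¬ ¬ (leavesP w P).b4 :=
  fun h => h (N02_inEdge_b4_at_record w hw P)

end Literature.MathematicalPhysics.QuantumFieldTheory.Balaban1983to89.Node00

end
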